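import Literature.AlgebraicGeometry.HodgeTheory.LefschetzDecompositionPolarizationForm
import Literature.AlgebraicGeometry.HodgeTheory.HodgeSectionRestrictionPairing
import Literature.AlgebraicGeometry.HodgeTheory.HodgeClassOfMorphismDuality
import Literature.AlgebraicGeometry.HodgeTheory.ComplexOrientationFamily
import Literature.AlgebraicGeometry.HodgeTheory.HardLefschetzNFold
import HarnessLib

/-!
# Route AmpleAdicLefschetz — crux `ThickDescent` (stmt-HodgeConjecture-2613), stub
# `stub_primitive_of_orthogonal`: the Lefschetz reduction to the primitive part

Let `f : Y ⟶ X` be a morphism of complex varieties with `Y` smooth projective of dimension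
`m = 2p + s`, and let `κ ∈ H²(X(ℂ); ℂ)` be a class whose restriction `κ_Y = f^*κ` has the hard
Lefschetz property in dimension `m` on `H•(Y(ℂ); ℂ)` (`Lʲ : H^{m-j} ≅ H^{m+j}`, `L = κ_Y ∪ ·`).
Write `x' = f^*x ∈ H²ᵖ(Y(ℂ); ℂ)` and `k = 2m - 2p`. If `f^*` is onto `Hⁱ(Y(ℂ); ℂ)` for all
`i ≤ 2p - 2` and `x' ∪ f^*y = 0` for every `y ∈ Hᵏ(X(ℂ); ℂ)`, then `x'` is PRIMITIVE:
`L^{s+1} x' = 0`.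

The argument is the bookkeeping of C. Voisin, *Hodge Theory and Complex Algebraic Geometry I*
(2002), Cor. 6.26 (Lefschetz decomposition, from hard Lefschetz Thm. 6.25) together with Poincaré
duality (Hatcher, Prop. 3.38), on the tree's PROVED Lefschetz decomposition of singular cohomology
(`LefschetzDecompositionSingular`, `LefschetzDecompositionPolarizationForm`):

* Lefschetz-decompose `x' = Σ_t Lᵗ x'_t`, `x'_t ∈ P^{2p-2t}` (`primitivePart`,
  `sum_lefschetzPowTo_primitivePart`).
* For `t ≥ 1` every `b ∈ H^{2p-2t}(Y(ℂ))` is `f^*v` (surjectivity in degree `2p - 2t ≤ 2p - 2`), and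
  `y = κ^{s+t} ∪ v` in the hypothesis gives `x' ∪ L^{s+t} b = 0` (naturality of `Lʲ`,
  `lefschetzPow_map`). Expanding `x'` and moving all powers of `κ_Y` onto one factor
  (`cupProduct_lefschetzPowTo_lefschetzPowTo`), the cross terms die by primitivity, leaving
  `x'_t ∪ L^{s+2t} b = 0` for all PRIMITIVE `b ∈ P^{2p-2t}`
  (`primitivePart_cup_lefschetzPowTo_eq_zero`).
* PERFECTNESS ON PRIMITIVES: a primitive `α ∈ Pᵈ` (`d + e = m`) with `α ∪ Lᵉ b = 0` for all
  primitive `b ∈ Pᵈ` satisfies `α ∪ Lᵉ z = 0` for all `z ∈ Hᵈ` (decompose `z`; the non-primitive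
  components are killed by the primitivity of `α`), hence `α ∪ w = 0` for all `w ∈ H^{2m-d}`
  (`Lᵉ : Hᵈ ≅ H^{2m-d}`, hard Lefschetz), hence `α = 0` (the cup pairing of the closed oriented
  manifold `Y(ℂ)` is perfect, `isPerfPair_cupPairing_complexPoints`).
* So `x'_t = 0` for `t ≥ 1`, `x' = x'_0` is primitive, and `L^{s+1} x' = 0`.

No named fact is introduced; everything used is PROVED in the tree.

## References

* [VoisinHodgeI2002] C. Voisin, Hodge Theory and Complex Algebraic Geometry I (CUP 2002), §6.2.3
  Def. 6.24, Thm. 6.25, Cor. 6.26, Rem. 6.27.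
* [HatcherAT2002] A. Hatcher, Algebraic Topology (CUP 2002), §3.2 p. 211 and Prop. 3.10, Thm. 3.11,
  §3.3 Prop. 3.38.
-/

noncomputable section

-- every declaration of this problem lives in `Summit.HodgeConjecture.HodgeConjecture.…` (summit = sub-problem)
set_option linter.dupNamespace false

universe u v

namespace Summit.HodgeConjecture.HodgeConjecture.Theorems

open CategoryTheory AlgebraicGeometry
open Literature.AlgebraicGeometry Literature.AlgebraicGeometry.Motives Literature.AlgebraicGeometry.HodgeTheory
open Literature.AlgebraicTopology.SingularHomology Literature.Geometry.Kaehler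

/-! ### Linear algebra of the Lefschetz decomposition (any space, any coefficient ring) -/

section General

variable {T : Type u} [TopologicalSpace T] {R : Type v} [CommRing R]
variable {κ : singularCohomology R R T 2} {n : ℕ} (hL : HasHardLefschetzProperty κ n)
  (hvan : ∀ m, 2 * n < m → Subsingleton (singularCohomology R R T m))

include hL hvan

/-- **Perfectness on primitives, step 1.** Let `α ∈ Pᵈ` be primitive, `d + e = n`, `d + 2e = c`,
and suppose `α ∪ Lᵉ b = 0` for every PRIMITIVE `b ∈ Pᵈ`. Then `α ∪ Lᵉ z = 0` for EVERY `z ∈ Hᵈ`: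
decompose `z = Σ_{a+2i=d} Lⁱ z_{(a,i)}` (Voisin I Cor. 6.26); the `i = 0` term is killed by the
hypothesis, and for `i ≥ 1`, `α ∪ L^{e+i} z_{(a,i)} = (L^{e+i} α) ∪ z_{(a,i)} = 0` since
`d + e + i ≥ n + 1` (Def. 6.24). [cite: VoisinHodgeI2002, §6.2.3 Def. 6.24 and Cor. 6.26] -/
private theorem cup_lefschetzPowTo_eq_zero_of_primitive {d e c s : ℕ} (hde : d + e = n)
    (hc : d + 2 * e = c) (hs : d + c = s) {α : singularCohomology R R T d}
    (hα : α ∈ primitiveClasses κ n d)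
    (horth : ∀ b ∈ primitiveClasses κ n d, cupProduct hs α (lefschetzPowTo κ e d c hc b) = 0)
    (z : singularCohomology R R T d) : cupProduct hs α (lefschetzPowTo κ e d c hc z) = 0 := by
  classical
  rw [← sum_lefschetzPowTo_primitivePart hL hvan z, map_sum, map_sum]
  refine Finset.sum_eq_zero fun q _ ↦ ?_
  obtain ⟨⟨a, i⟩, hq⟩ := q
  have hq' : a + 2 * i = d := hq
  change cupProduct hs α (lefschetzPowTo κ e d c hc
    (lefschetzPowTo κ i a d hq' (primitivePart κ n hL hvan ⟨(a, i), hq⟩ z))) = 0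
  have hξ : primitivePart κ n hL hvan ⟨(a, i), hq⟩ z ∈ primitiveClasses κ n a :=
    primitivePart_mem hL hvan _ z
  rcases Nat.eq_zero_or_pos i with rfl | hi
  · -- `i = 0`: `a = d`, the term is `α ∪ Lᵉ z_{(d,0)}` with `z_{(d,0)}` primitive
    obtain rfl : a = d := by omega
    rw [lefschetzPowTo_zero_eq_id κ hq', LinearMap.id_apply]
    exact horth _ hξ
  · -- `i ≥ 1`: move all powers of `κ` onto `α`, which is primitive
    rw [lefschetzPowTo_lefschetzPowTo κ e hq' hc (show a + 2 * (i + e) = c by omega),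
      cupProduct_lefschetzPowTo_right κ (i + e) (show a + 2 * (i + e) = c by omega) hs rfl
        (show d + a + 2 * (i + e) = s by omega),
      ← cupProduct_lefschetzPowTo_left κ (i + e) rfl (show d + 2 * (i + e) + a = s by omega) rfl
        (show d + a + 2 * (i + e) = s by omega),
      lefschetzPowTo_eq_zero_of_mem_primitiveClasses hα rfl (show n + 1 ≤ d + (i + e) by omega),
      map_zero, LinearMap.zero_apply]

/-- **Perfectness on primitives, step 2.** Under the hypotheses of
`cup_lefschetzPowTo_eq_zero_of_primitive`, `α ∪ w = 0` for EVERY `w ∈ Hᶜ`, `c = d + 2e = 2n - d`: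
`Lᵉ : Hᵈ → Hᶜ` is onto by hard Lefschetz (`d + e = n`, Voisin I Thm. 6.25).
[cite: VoisinHodgeI2002, §6.2.3 Thm. 6.25 and Cor. 6.26] -/
private theorem cup_eq_zero_of_primitive {d e c s : ℕ} (hde : d + e = n) (hc : d + 2 * e = c)
    (hs : d + c = s) {α : singularCohomology R R T d} (hα : α ∈ primitiveClasses κ n d)
    (horth : ∀ b ∈ primitiveClasses κ n d, cupProduct hs α (lefschetzPowTo κ e d c hc b) = 0)
    (w : singularCohomology R R T c) : cupProduct hs α w = 0 := by
  obtain ⟨z, rfl⟩ := (bijective_lefschetzPowTo_of_hasHardLefschetz κ hL hde c hc).2 w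
  exact cup_lefschetzPowTo_eq_zero_of_primitive hL hvan hde hc hs hα horth z

/-- **The primitive components pair to zero with primitives.** Let `x ∈ Hⁱ` and fix an index
`(a, t)`, `a + 2t = i`, and an exponent `r` with `a + t + r = n`. If `x ∪ Lʳ b = 0` for every
`b ∈ Hᵃ`, then the primitive part `ξ = ξ_{(a,t)} x ∈ Pᵃ` satisfies `ξ ∪ L^{t+r} b = 0` for every
PRIMITIVE `b ∈ Pᵃ` (`t + r = n - a` is the Lefschetz-dual exponent of degree `a`). Indeed, expanding
`x = Σ_{(a',t')} L^{t'} ξ_{(a',t')} x` (Voisin I Cor. 6.26) and moving the powers of `κ` onto one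
factor, the `(a', t')`-term is `ξ_{(a',t')} x ∪ L^{t'+r} b`; for `t' > t` it vanishes because `b` is
primitive (`a + t' + r ≥ n + 1`), for `t' < t` because `ξ_{(a',t')} x` is (`a' + t' + r ≥ n + 1`),
and `t' = t` forces `(a', t') = (a, t)`. [cite: VoisinHodgeI2002, §6.2.3 Def. 6.24 and Cor. 6.26]
[cite: HatcherAT2002, §3.2 p. 211 and Thm. 3.11] -/
private theorem primitivePart_cup_lefschetzPowTo_eq_zero {i a t r K S c : ℕ} (hat : a + 2 * t = i)
    (hn : a + t + r = n) (hK : a + 2 * r = K) (hS : i + K = S) (hc : a + 2 * (t + r) = c)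
    (hcS : a + c = S) (x : singularCohomology R R T i)
    (H : ∀ b : singularCohomology R R T a, cupProduct hS x (lefschetzPowTo κ r a K hK b) = 0)
    {b : singularCohomology R R T a} (hb : b ∈ primitiveClasses κ n a) :
    cupProduct hcS (primitivePart κ n hL hvan ⟨(a, t), hat⟩ x)
      (lefschetzPowTo κ (t + r) a c hc b) = 0 := by
  classical
  have key : cupProduct hS (lefschetzPowTo κ t a i hat (primitivePart κ n hL hvan ⟨(a, t), hat⟩ x))
      (lefschetzPowTo κ r a K hK b) = 0 := by
    have hsum := H b
    rw [← sum_lefschetzPowTo_primitivePart hL hvan x, map_sum, LinearMap.sum_apply,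
      Finset.sum_eq_single (⟨(a, t), hat⟩ : {q : ℕ × ℕ // q.1 + 2 * q.2 = i})] at hsum
    · exact hsum
    · rintro ⟨⟨a', t'⟩, hq⟩ - hne
      have hq' : a' + 2 * t' = i := hq
      change cupProduct hS
        (lefschetzPowTo κ t' a' i hq' (primitivePart κ n hL hvan ⟨(a', t'), hq⟩ x))
        (lefschetzPowTo κ r a K hK b) = 0
      rw [cupProduct_lefschetzPowTo_lefschetzPowTo κ t' r hq' hK hS rfl
        (show a' + (a + 2 * (t' + r)) = S by omega)]
      rcases lt_trichotomy t' t with hlt | heq | hgt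
      · -- `t' < t`: the primitive part `ξ_{(a',t')} x` is killed by `L^{t'+r}`
        have hξ' : primitivePart κ n hL hvan ⟨(a', t'), hq⟩ x ∈ primitiveClasses κ n a' :=
          primitivePart_mem hL hvan _ x
        rw [cupProduct_lefschetzPowTo_right κ (t' + r) rfl _ rfl
            (show a' + a + 2 * (t' + r) = S by omega),
          ← cupProduct_lefschetzPowTo_left κ (t' + r) rfl (show a' + 2 * (t' + r) + a = S by omega)
            rfl (show a' + a + 2 * (t' + r) = S by omega),
          lefschetzPowTo_eq_zero_of_mem_primitiveClasses hξ' rfl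
            (show n + 1 ≤ a' + (t' + r) by omega), map_zero, LinearMap.zero_apply]
      · -- `t' = t`: then `a' = a`, contradicting `(a', t') ≠ (a, t)`
        exact absurd (Subtype.ext <| Prod.ext (show a' = a by omega) heq) hne
      · -- `t' > t`: the primitive class `b` is killed by `L^{t'+r}`
        rw [lefschetzPowTo_eq_zero_of_mem_primitiveClasses hb rfl
          (show n + 1 ≤ a + (t' + r) by omega), map_zero]
    · exact fun h ↦ absurd (Finset.mem_univ _) h
  rw [cupProduct_lefschetzPowTo_lefschetzPowTo κ t r hat hK hS hc hcS] at key
  exact key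

end General

/-! ### Poincaré duality and the primitivity criterion on `Y(ℂ)` -/

/-- **A class pairing to zero with every class of complementary degree vanishes**: for `Y` smooth
projective of dimension `m` and `d + c = 2m`, if `α ∪ w = 0` for all `w ∈ Hᶜ(Y(ℂ); ℂ)` then `α = 0`
(the cup pairing `(α, w) ↦ ⟨α ∪ w, [Y(ℂ)]⟩` of the closed oriented manifold `Y(ℂ)` is perfect,
`isPerfPair_cupPairing_complexPoints`, Hatcher Prop. 3.38).
[cite: HatcherAT2002, §3.3 Prop. 3.38] -/
private theorem eq_zero_of_forall_cupProduct_eq_zero {m : ℕ} {Y : SchemeOver ℂ}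
    (hY : IsSmoothProjective m Y) {d c : ℕ} (h : d + c = 2 * m) {α : complexBetti Y d}
    (hα : ∀ w : complexBetti Y c, cupProduct h α w = 0) : α = 0 := by
  apply (isPerfPair_cupPairing_complexPoints complexOrientationFamily hY h).bijective_left.injective
  rw [map_zero]
  ext w
  rw [cupPairing_apply, hα w, map_zero, LinearMap.zero_apply, LinearMap.zero_apply]

/-- **Primitivity criterion** (the `Y`-side of the stub): `Y` smooth projective of dimension
`m = 2p + s`, `κ ∈ H²(Y(ℂ); ℂ)` with the hard Lefschetz property in dimension `m`, `2p + k = 2m`,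
`x ∈ H²ᵖ(Y(ℂ); ℂ)`. If `x ∪ L^{s+t} b = 0` for every `t ≥ 1`, `a + 2t = 2p` and `b ∈ Hᵃ(Y(ℂ); ℂ)`,
then `x` is primitive, `L^{s+1} x = 0`: by `primitivePart_cup_lefschetzPowTo_eq_zero` every
Lefschetz component `ξ_{(a,t)} x`, `t ≥ 1`, pairs to zero with `L^{s+2t} P^a`, hence vanishes
(`cup_eq_zero_of_primitive`, `eq_zero_of_forall_cupProduct_eq_zero`), so `x = ξ_{(2p,0)} x` is its
own primitive part (Voisin I Cor. 6.26) and `L^{m-2p+1} x = 0` (Def. 6.24).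
[cite: VoisinHodgeI2002, §6.2.3 Def. 6.24, Thm. 6.25 and Cor. 6.26]
[cite: HatcherAT2002, §3.3 Prop. 3.38] -/
private theorem lefschetzPowTo_eq_zero_of_cup_lefschetzPowTo_eq_zero {m : ℕ} {Y : SchemeOver ℂ}
    (hY : IsSmoothProjective m Y) {κ : complexBetti Y 2} (hL : HasHardLefschetzProperty κ m)
    {p s k : ℕ} (hs : 2 * p + s = m) (hk : 2 * p + k = 2 * m) (x : complexBetti Y (2 * p))
    (H : ∀ (t a : ℕ) (hat : a + 2 * t = 2 * p) (hak : a + 2 * (s + t) = k), 0 < t →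
      ∀ b : complexBetti Y a, cupProduct hk x (lefschetzPowTo κ (s + t) a k hak b) = 0) :
    lefschetzPowTo κ (s + 1) (2 * p) (2 * p + 2 * (s + 1)) rfl x = 0 := by
  classical
  have hvan : ∀ m', 2 * m < m' → Subsingleton (complexBetti Y m') :=
    fun m' h ↦ subsingleton_complexBetti hY h
  -- every Lefschetz component `ξ_{(a,t)} x` with `t ≥ 1` vanishes
  have hcomp : ∀ q : {q : ℕ × ℕ // q.1 + 2 * q.2 = 2 * p}, 0 < q.1.2 →
      primitivePart κ m hL hvan q x = 0 := by
    rintro ⟨⟨a, t⟩, hat⟩ ht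
    have hat' : a + 2 * t = 2 * p := hat
    have ht' : 0 < t := ht
    refine eq_zero_of_forall_cupProduct_eq_zero hY
      (show a + (a + 2 * (t + (s + t))) = 2 * m by omega) fun w ↦ ?_
    exact cup_eq_zero_of_primitive hL hvan (d := a) (e := t + (s + t)) (by omega) rfl _
      (primitivePart_mem hL hvan _ x)
      (fun b hb ↦ primitivePart_cup_lefschetzPowTo_eq_zero hL hvan hat'
        (show a + t + (s + t) = m by omega) (show a + 2 * (s + t) = k by omega) hk rfl _ x
        (H t a hat' _ ht') hb) w
  -- hence `x = ξ_{(2p,0)} x` is its own primitive part, so it is primitive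
  have hx : x ∈ primitiveClasses κ m (2 * p) := by
    have hsum := sum_lefschetzPowTo_primitivePart hL hvan x
    rw [Finset.sum_eq_single (⟨(2 * p, 0), rfl⟩ : {q : ℕ × ℕ // q.1 + 2 * q.2 = 2 * p})] at hsum
    · change lefschetzPowTo κ 0 (2 * p) (2 * p) rfl
        (primitivePart κ m hL hvan ⟨(2 * p, 0), rfl⟩ x) = x at hsum
      rw [lefschetzPowTo_zero_apply] at hsum
      rw [← hsum]
      exact primitivePart_mem hL hvan _ x
    · rintro ⟨⟨a, t⟩, hat⟩ - hne
      have hat' : a + 2 * t = 2 * p := hat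
      rcases Nat.eq_zero_or_pos t with rfl | ht
      · exfalso
        apply hne
        obtain rfl : a = 2 * p := by omega
        rfl
      · change lefschetzPowTo κ t a (2 * p) hat' (primitivePart κ m hL hvan ⟨(a, t), hat⟩ x) = 0
        rw [hcomp ⟨(a, t), hat⟩ ht, map_zero]
    · exact fun h ↦ absurd (Finset.mem_univ _) h
  exact lefschetzPowTo_eq_zero_of_mem_primitiveClasses hx rfl (by omega)

/-! ### Naturality of the Lefschetz iterates -/

/-- **`f^*(Lʲ_κ c) = Lʲ_{f^*κ}(f^* c)`**: the iterated Lefschetz operator with explicit target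
degree is natural for pull-backs (the cup product is, Hatcher Prop. 3.10; the tree's
`lefschetzPow_map`). [cite: HatcherAT2002, §3.2 Prop. 3.10] -/
private theorem complexBetti_map_lefschetzPowTo {X Y : SchemeOver ℂ} (f : Y ⟶ X)
    (κ : complexBetti X 2) (j k l : ℕ) (hl : k + 2 * j = l) (c : complexBetti X k) :
    complexBetti.map f l (lefschetzPowTo κ j k l hl c) =
      lefschetzPowTo (complexBetti.map f 2 κ) j k l hl (complexBetti.map f k c) := by
  subst hl
  exact lefschetzPow_map _ κ j k c

/-! ### The stub -/

/-- **Stub `stub_primitive_of_orthogonal` of the crux `ThickDescent`** — LEFSCHETZ REDUCTION TO THE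
PRIMITIVE PART: `Y` smooth projective of dimension `m = 2p + s`, `f : Y ⟶ X` a morphism,
`κ ∈ H²(X(ℂ); ℂ)` a class whose restriction `f^* κ` has the hard Lefschetz property in
dimension `m`; if `f^*` is onto `Hⁱ(Y(ℂ); ℂ)` for all `i ≤ 2p - 2` and `f^* x ∪ f^* y = 0` for
every `y ∈ H^{2m-2p}(X(ℂ); ℂ)`, then `f^* x` is PRIMITIVE: `L^{s+1}_{f^*κ} (f^* x) = 0`. Proof: for
`t ≥ 1`, `a + 2t = 2p`, every `b ∈ Hᵃ(Y(ℂ))` is `f^* v` (surjectivity, `a ≤ 2p - 2`), and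
`y = κ^{s+t} ∪ v` gives `f^* x ∪ L^{s+t} b = f^* x ∪ f^* y = 0`
(`complexBetti_map_lefschetzPowTo`); conclude by the primitivity criterion
`lefschetzPowTo_eq_zero_of_cup_lefschetzPowTo_eq_zero` (Lefschetz decomposition, Voisin I
Cor. 6.26, and Poincaré duality, Hatcher Prop. 3.38).
[cite: VoisinHodgeI2002, §6.2.3 Thm. 6.25 and Cor. 6.26] [cite: HatcherAT2002, §3.3 Prop. 3.38] -/
theorem stub_primitive_of_orthogonal :
    ∀ ⦃m p s k : ℕ⦄ ⦃X Y : SchemeOver ℂ⦄ (f : Y ⟶ X) (hY : IsSmoothProjective m Y)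
      (hs : 2 * p + s = m) (hk : 2 * p + k = 2 * m) (κ : complexBetti X 2),
      HasHardLefschetzProperty (complexBetti.map f 2 κ) m →
      (∀ i : ℕ, i + 2 ≤ 2 * p → Function.Surjective (complexBetti.map f i)) →
      ∀ (x : complexBetti X (2 * p)),
      (∀ y : complexBetti X k,
        cupProduct hk (complexBetti.map f (2 * p) x) (complexBetti.map f k y) = 0) →
      lefschetzPowTo (complexBetti.map f 2 κ) (s + 1) (2 * p) (2 * p + 2 * (s + 1)) rfl
        (complexBetti.map f (2 * p) x) = 0 := by
  intro m p s k X Y f hY hs hk κ hL hsurj x horth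
  refine lefschetzPowTo_eq_zero_of_cup_lefschetzPowTo_eq_zero hY hL hs hk _ ?_
  intro t a hat hak ht b
  -- `b = f^* v` (surjectivity in degree `a = 2p - 2t ≤ 2p - 2`)
  obtain ⟨v, rfl⟩ := hsurj a (by omega) b
  -- `L^{s+t}_{f^*κ} (f^* v) = f^* (κ^{s+t} ∪ v)`, and `f^* x ⊥ f^* H^k(X)`
  rw [← complexBetti_map_lefschetzPowTo f κ (s + t) a k hak v]
  exact horth _

end Summit.HodgeConjecture.HodgeConjecture.Theorems

end
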